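import Summits.AtomisticToContinuum.Crystallization.Theorems.FrustratedLawDichotomyStrainedPatchHomValueT2SoundT

/-!
# (I1) part U — KIT BOOKKEEPING III for the joint value leaf (roadmap for `valueLeafT2J_sound`, step 5c): box memberships ALONG THE SEGMENT
# `U_c + t(U − U_c)`, `ξ_c + t(ξ − ξ_c)` (entries in `boxE`, shuffles in `shufFI`, label arguments in `pA` / `qB`; the centre in `cenE` / `cenX`),
# the `A`-family displacement (`dispN ΔU 0`), sign facts (`rad ≥ 0`, `absHi ≥ 0`), the label-count bound `|nearA|, |nearB| ≤ 3375`, and ★ the unpacking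
# of the verdict `valueLeafT2J μ c w = true` into the guards and the integer inequality of `t2ReportJ`
# (27623 `(H) HomFloor`, hcp half; decomp-a2c hand-1 g49; critic row 1674 (B) (I1) docket).

No definitions; 0 sorry; standard axioms; no instances / notation / `#eval`.  `--supports stmt-AtomisticToContinuum-27623`.
-/

noncomputable section

namespace Summit.AtomisticToContinuum.Crystallization.Theorems.FrustratedLawDichotomyStrainedPatchHomValueT2Kit

open scoped BigOperators RealInnerProductSpace
open Finset
open Literature.Analysis.ValidatedNumerics.Numerics
open Summit.AtomisticToContinuum.Crystallization.Theorems.ChargedEnergyGapNegative (E3)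
open Summit.AtomisticToContinuum.Crystallization.Theorems.FrustratedLawDichotomyStrainedPatchHomSplit (latPt hexFrame hcpShift)
open Summit.AtomisticToContinuum.Crystallization.Theorems.FrustratedLawDichotomyStrainedPatchHomEntryGram (cen rad mem_entryFI)
open Summit.AtomisticToContinuum.Crystallization.Theorems.FrustratedLawDichotomyStrainedPatchHomEntryGramHcp (shufFI mem_shufFI)
open Summit.AtomisticToContinuum.Crystallization.Theorems.FrustratedLawDichotomyStrainedPatchHomCurvCentreKit
  (boxE cenE cenX cenMap cenShuf zW cenMap_box cenShuf_box cenMap_entry cenShuf_apply)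
open Summit.AtomisticToContinuum.Crystallization.Theorems.FrustratedLawDichotomyStrainedPatchHomCurvLeaf (boxLabels7 boxLabels7_toFinset boxLabels7_nodup)

/-! ## §1. Memberships along the segment and at the centre -/

/-- ★ Entries of `U_c + t(U − U_c)` (`t ∈ [0,1]`) lie in the entry box of `U`'s box. [arithmetic: convexity] -/
theorem mem_boxE_segment {c w : (Fin 3 × Fin 3) ⊕ Fin 3 → ℤ} (U : E3 →L[ℝ] E3)
    (hbox : ∀ ab : Fin 3 × Fin 3, |(U (EuclideanSpace.single ab.2 (1 : ℝ))) ab.1 - (c (Sum.inl ab) : ℝ) / SC| ≤ (w (Sum.inl ab) : ℝ) / SC)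
    {t : ℝ} (ht : t ∈ Set.Icc (0 : ℝ) 1) (ab : Fin 3 × Fin 3) :
    FI.mem (((cenMap c + t • (U - cenMap c)) (EuclideanSpace.single ab.2 (1 : ℝ))) ab.1) (boxE c w ab) := by
  refine mem_entryFI ?_
  have e : ((cenMap c + t • (U - cenMap c)) (EuclideanSpace.single ab.2 (1 : ℝ))) ab.1 =
      (c (Sum.inl ab) : ℝ) / SC + t * ((U (EuclideanSpace.single ab.2 (1 : ℝ))) ab.1 - (c (Sum.inl ab) : ℝ) / SC) := by
    show ent (cenMap c + t • (U - cenMap c)) ab.1 ab.2 = _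
    rw [ent_path, ent_sub, ent_cenMap]
    rfl
  rw [e, add_sub_cancel_left, abs_mul, abs_of_nonneg ht.1]
  calc t * |(U (EuclideanSpace.single ab.2 (1 : ℝ))) ab.1 - (c (Sum.inl ab) : ℝ) / SC|
      ≤ 1 * |(U (EuclideanSpace.single ab.2 (1 : ℝ))) ab.1 - (c (Sum.inl ab) : ℝ) / SC| := mul_le_mul_of_nonneg_right ht.2 (abs_nonneg _)
    _ ≤ (w (Sum.inl ab) : ℝ) / SC := by rw [one_mul]; exact hbox ab

/-- The centre's entries lie in the zero-width centre box. [formal bookkeeping] -/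
theorem mem_cenE (c : (Fin 3 × Fin 3) ⊕ Fin 3 → ℤ) (ab : Fin 3 × Fin 3) : FI.mem ((cenMap c (EuclideanSpace.single ab.2 (1 : ℝ))) ab.1) (cenE c ab) :=
  mem_entryFI (cenMap_box c ab)

/-- ★ Coordinates of `ξ_c + t(ξ − ξ_c)` (`t ∈ [0,1]`) lie in the shuffle box. [arithmetic: convexity] -/
theorem mem_shuf_segment {c w : (Fin 3 × Fin 3) ⊕ Fin 3 → ℤ} (ξ : E3)
    (hξ : ∀ i : Fin 3, |ξ i - (c (Sum.inr i) : ℝ) / SC| ≤ (w (Sum.inr i) : ℝ) / SC) {t : ℝ} (ht : t ∈ Set.Icc (0 : ℝ) 1) (i : Fin 3) :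
    FI.mem ((cenShuf c + t • (ξ - cenShuf c)) i) (shufFI c w i) := by
  refine mem_shufFI ?_
  have e : (cenShuf c + t • (ξ - cenShuf c)) i = (c (Sum.inr i) : ℝ) / SC + t * (ξ i - (c (Sum.inr i) : ℝ) / SC) := by
    simp only [PiLp.add_apply, PiLp.smul_apply, PiLp.sub_apply, smul_eq_mul, cenShuf_apply]
  rw [e, add_sub_cancel_left, abs_mul, abs_of_nonneg ht.1]
  calc t * |ξ i - (c (Sum.inr i) : ℝ) / SC| ≤ 1 * |ξ i - (c (Sum.inr i) : ℝ) / SC| := mul_le_mul_of_nonneg_right ht.2 (abs_nonneg _)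
    _ ≤ (w (Sum.inr i) : ℝ) / SC := by rw [one_mul]; exact hξ i

/-- The centre shuffle lies in the zero-width centre shuffle box. [formal bookkeeping] -/
theorem mem_cenX (c : (Fin 3 × Fin 3) ⊕ Fin 3 → ℤ) (i : Fin 3) : FI.mem (cenShuf c i) (cenX c i) := mem_shufFI (cenShuf_box c i)

/-- ★ The `B`-family argument along the segment: components of `(p_b + hcpShift + ξ_c) + t(ξ − ξ_c)` lie in `qB (shufFI c w) b`. [folklore chaining] -/
theorem mem_qB_segment {c w : (Fin 3 × Fin 3) ⊕ Fin 3 → ℤ} (ξ : E3)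
    (hξ : ∀ i : Fin 3, |ξ i - (c (Sum.inr i) : ℝ) / SC| ≤ (w (Sum.inr i) : ℝ) / SC) {t : ℝ} (ht : t ∈ Set.Icc (0 : ℝ) 1) (b : Fin 3 → ℤ) (a : Fin 3) :
    FI.mem (((latPt (1 : E3 →L[ℝ] E3) hexFrame b + (hcpShift + cenShuf c)) + t • (ξ - cenShuf c)) a) (qB (shufFI c w) b a) := by
  have e : (latPt (1 : E3 →L[ℝ] E3) hexFrame b + (hcpShift + cenShuf c)) + t • (ξ - cenShuf c) =
      latPt (1 : E3 →L[ℝ] E3) hexFrame b + (hcpShift + (cenShuf c + t • (ξ - cenShuf c))) := by abel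
  rw [e]
  exact mem_qB (fun i => mem_shuf_segment ξ hξ ht i) b a

/-- The `B`-family argument at the centre. [folklore chaining] -/
theorem mem_qB_cen (c : (Fin 3 × Fin 3) ⊕ Fin 3 → ℤ) (b : Fin 3 → ℤ) (a : Fin 3) :
    FI.mem ((latPt (1 : E3 →L[ℝ] E3) hexFrame b + (hcpShift + cenShuf c)) a) (qB (cenX c) b a) := mem_qB (fun i => mem_cenX c i) b a

/-- The `A`-family argument (constant along the segment). [folklore chaining] -/
theorem mem_pA_segment (b : Fin 3 → ℤ) (t : ℝ) (a : Fin 3) :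
    FI.mem ((latPt (1 : E3 →L[ℝ] E3) hexFrame b + t • (0 : E3)) a) (pA b a) := by
  rw [smul_zero, add_zero]; exact mem_pA b a

/-! ## §2. The `A`-family displacement, sign facts, label counts -/

/-- ★ With `Δξ = 0` the folded displacement keeps the `U`-coordinates and kills the `ξ`-coordinates. [formal bookkeeping] -/
theorem dispN_xi_zero (ΔU : E3 →L[ℝ] E3) (Δξ : E3) {k : ℕ} (hk : k < 9) : dispN ΔU 0 k = if k < 6 then dispN ΔU Δξ k else 0 := by
  interval_cases k <;> simp [dispN]

/-- `rad I ≥ 0` for an interval with a member. [arithmetic] -/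
theorem rad_nonneg {x : ℝ} {I : FI} (h : FI.mem x I) : 0 ≤ rad I := by
  have := FI.lo_le_hi h
  unfold rad cen
  omega

/-- `absHi ≥ 0`. [arithmetic] -/
theorem absHi_nonneg (I : FI) : 0 ≤ I.absHi := le_max_of_le_left (abs_nonneg _)

/-- The near-label lists have at most `15³ = 3375` members. [formal bookkeeping] -/
theorem length_near_le (c w : (Fin 3 × Fin 3) ⊕ Fin 3 → ℤ) : (nearA c w).length ≤ 3375 ∧ (nearB c w).length ≤ 3375 := by
  have hlen : boxLabels7.length = 3375 := by
    rw [← List.toFinset_card_of_nodup boxLabels7_nodup, boxLabels7_toFinset, Fintype.card_piFinset]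
    simp
  constructor
  · unfold nearA; exact (List.length_filter_le _ _).trans hlen.le
  · unfold nearB; exact (List.length_filter_le _ _).trans hlen.le

/-! ## §3. ★ Unpacking the verdict -/

/-- ★★ **THE VERDICT UNPACKED**: `valueLeafT2J μ c w = true` yields the value `v` at the centre, the PSD shift `κ`, the three guards, and the integer
leaf inequality `μ ≤ v + boxMin − penP − penL − pen0` of `t2ReportJ`. [formal bookkeeping] -/
theorem of_valueLeafT2J {μ : ℤ} {c w : (Fin 3 × Fin 3) ⊕ Fin 3 → ℤ} (h : valueLeafT2J μ c w = true) :
    ∃ v κ : ℤ, valueP μ c = some v ∧ kappaShift ((passP c (nearA c w) (nearB c w)).H.map cen) = some κ ∧ foldGuard c w = true ∧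
      (passP c (nearA c w) (nearB c w)).ok = true ∧
      (passJ c w (Array.ofFn fun p : Fin 9 => foldW w p) (nearA c w) (nearB c w)).ok = true ∧
      symOK ((passP c (nearA c w) (nearB c w)).H.map cen) = true ∧
      0 ≤ v + boxMin ((passP c (nearA c w) (nearB c w)).H.map cen) ((passP c (nearA c w) (nearB c w)).g.map cen)
          (Array.ofFn fun p : Fin 9 => foldW w p) κ
          (anchor ((passP c (nearA c w) (nearB c w)).H.map cen) ((passP c (nearA c w) (nearB c w)).g.map cen)
            (Array.ofFn fun p : Fin 9 => foldW w p) 40) -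
        (cdiv ((List.range 9).foldl (fun s k => s + ((passP c (nearA c w) (nearB c w)).g.map rad).getD k 0 *
            (Array.ofFn fun p : Fin 9 => foldW w p).getD k 0) 0) (SC : ℤ) +
          cdiv ((List.range 9).foldl (fun s k => (List.range 9).foldl (fun s2 l => s2 +
            (((passP c (nearA c w) (nearB c w)).H.map rad).getD (9 * k + l) 0) * (Array.ofFn fun p : Fin 9 => foldW w p).getD k 0 *
              (Array.ofFn fun p : Fin 9 => foldW w p).getD l 0) s) 0) (2 * (SC : ℤ) * (SC : ℤ))) -
        cdiv (passJ c w (Array.ofFn fun p : Fin 9 => foldW w p) (nearA c w) (nearB c w)).pen6 (6 * (SC : ℤ) * (SC : ℤ)) -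
        cdiv (passJ c w (Array.ofFn fun p : Fin 9 => foldW w p) (nearA c w) (nearB c w)).pen0 (2 * (SC : ℤ) * (SC : ℤ)) - μ := by
  unfold valueLeafT2J t2ReportJ at h
  simp only [Bool.and_eq_true, decide_eq_true_eq] at h
  obtain ⟨h1, h2⟩ := h
  cases hv : valueP μ c with
  | none => simp [hv] at h1
  | some v =>
    cases hκ : kappaShift ((passP c (nearA c w) (nearB c w)).H.map cen) with
    | none => simp [hv, hκ] at h1
    | some κ =>
      simp only [hv, hκ, Bool.and_eq_true] at h1 h2
      obtain ⟨⟨⟨hg, hP⟩, hA⟩, hs⟩ := h1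
      exact ⟨v, κ, rfl, rfl, hg, hP, hA, hs, h2⟩

end Summit.AtomisticToContinuum.Crystallization.Theorems.FrustratedLawDichotomyStrainedPatchHomValueT2Kit
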